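import Summits.ResolutionOfSingularities.ResolutionOfSingularities.Theorems.FrobeniusLadderFRationalResolutionChartTransfer
import Summits.ResolutionOfSingularities.ResolutionOfSingularities.Theorems.FrobeniusLadderFRationalResolutionConeModels
import Mathlib.RingTheory.Localization.Away.AdjoinRoot
import HarnessLib

/-!
# Crux `FrobeniusLadder.FRationalResolution` (stmt-ResolutionOfSingularities-15317), line `redirect`,
# stub `stub_diagonalizableQuotientResolution` — local resolution at an isolated singular point from a flat chart
# with a regular blow-up of the descended centre (scheme form)

Brick T3-e of the repair census, the scheme-level wrapper of `…ChartTransfer.coneModelData_of_flat_chart`: an affine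
open `ι : Spec B ↪ X` of the integral `k`-scheme `X` around an isolated singular closed point `ι 𝔭`, a flat finitely
presented chart `B → C` whose image contains `𝔭`, and a `𝔭`-primary `I ⊆ B` with `Bl_{IC}` regular give the local
resolution datum `hloc` of `IsolatedGlue.hasResolution_of_finite_singularLocus_of_local` at `ι 𝔭`
(`ConeModels.hloc_of_cone_model` applied to the model `(B_h, I B_h, q)` with the germ isomorphism of the open immersion
`Spec B_h → Spec B → X`).

* `hloc_of_affineOpen_model` — `hloc_of_cone_model` for a one-blow-up model living on an affine OPEN of `X` (germ
  isomorphism = stalk map of the open immersion, `Scheme.SpecMap_stalkMap_fromSpecStalk`);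
* `hloc_of_flat_chart` — **the assembled transfer**.

Honest label: plumbing (no stub closed); what remains for the étale-chart isolated case is upstairs (T1 + L3: the
chart-side regular `𝔪`-primary blow-up) and the residue-triviality needed by `…CentreDescent`. No definitions, no
named facts, no sorry. [folklore; cite: Kollar2007, §2.2]
-/

noncomputable section

-- single-problem summit: the doubled namespace component is forced
set_option linter.dupNamespace false

open CategoryTheory AlgebraicGeometry TopologicalSpace
open Literature.AlgebraicGeometry.Resolution

namespace Summit.ResolutionOfSingularities.ResolutionOfSingularities.Theorems.FRationalResolution.ChartHloc

/-- **Local resolution from a one-blow-up model on an affine open of `X`.** Let `ι : Spec R → X` be an open immersion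
over `k` (`R` a domain of finite type over `k`, `X` integral locally of finite type), `I ⊆ R` finitely generated and
non-zero with `Bl_I(Spec R)` regular, the regular locus of `Spec R` equal to the complement of `V(I)`, and
`V(I) ⊆ {q}`. Then `ι q` has an open neighbourhood `V` containing no other singular point and a proper
`ρ : Y → V`, `Y` regular, an isomorphism over `V ∩ Reg X` with dense preimage. [cite: Kollar2007, §2.2] -/
theorem hloc_of_affineOpen_model (k : Type) [Field k] (X : Scheme.{0}) [IsIntegral X]
    (f : X ⟶ Spec (.of k)) [LocallyOfFiniteType f]
    (R : Type) [CommRing R] [IsDomain R] [Algebra k R] [Algebra.FiniteType k R]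
    (ι : Spec (.of R) ⟶ X) [IsOpenImmersion ι] (hι : ι ≫ f = Spec.map (CommRingCat.ofHom (algebraMap k R)))
    (I : Ideal R) (hfg : I.FG) (hI : I ≠ ⊥) (hreg : Scheme.IsRegular (affineBlowup I))
    (hRegI : ∀ P : Spec (.of R), P ∈ Scheme.regularLocus (Spec (.of R)) ↔ ¬ I ≤ P.asIdeal)
    (q : Spec (.of R)) (hq : ∀ t : Spec (.of R), I ≤ t.asIdeal → t = q) :
    ∃ (V : X.Opens), ι q ∈ V ∧ (∀ t : X, t ∉ Scheme.regularLocus X → t ∈ V → t = ι q) ∧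
      ∃ (Y : Scheme.{0}) (ρ : Y ⟶ V), IsProper ρ ∧ Scheme.IsRegular Y ∧
        IsIso (ρ ∣_ (V.ι ⁻¹ᵁ ⟨Scheme.regularLocus X, isOpen_regularLocus_of_locallyOfFiniteType_field f⟩)) ∧
        Dense ((ρ ⁻¹ᵁ (V.ι ⁻¹ᵁ ⟨Scheme.regularLocus X,
          isOpen_regularLocus_of_locallyOfFiniteType_field f⟩) : Y.Opens) : Set Y) := by
  haveI : LocallyOfFiniteType (Spec.map (CommRingCat.ofHom (algebraMap k R))) := by
    rw [HasRingHomProperty.Spec_iff (P := @LocallyOfFiniteType), CommRingCat.hom_ofHom]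
    exact RingHom.finiteType_algebraMap.mpr inferInstance
  -- the germ isomorphism of the open immersion
  let e : (Spec (.of R)).presheaf.stalk q ≅ X.presheaf.stalk (ι q) := (asIso (ι.stalkMap q)).symm
  have he : Spec.map e.hom ≫ (Spec (.of R)).fromSpecStalk q ≫
      Spec.map (CommRingCat.ofHom (algebraMap k R)) = X.fromSpecStalk (ι q) ≫ f := by
    rw [← hι]
    have hnat := Scheme.SpecMap_stalkMap_fromSpecStalk ι (x := q)
    -- `hnat : Spec.map (ι.stalkMap q) ≫ X.fromSpecStalk (ι q) = (Spec R).fromSpecStalk q ≫ ι`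
    have h1 : (Spec (.of R)).fromSpecStalk q ≫ ι ≫ f =
        Spec.map (ι.stalkMap q) ≫ X.fromSpecStalk (ι q) ≫ f := by
      rw [← Category.assoc, ← hnat, Category.assoc]
    rw [h1]
    change Spec.map (inv (ι.stalkMap q)) ≫ Spec.map (ι.stalkMap q) ≫ X.fromSpecStalk (ι q) ≫ f = _
    rw [← Category.assoc, ← Spec.map_comp, IsIso.hom_inv_id, Spec.map_id, Category.id_comp]
  exact ConeModels.hloc_of_cone_model k X f (ι q) R I hfg hI hreg hRegI q hq e he

/-- **Local resolution at an isolated singular point from a flat chart with a regular blow-up of the descended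
centre.** Let `X` be an integral `k`-scheme locally of finite type, `ι : Spec B → X` an affine open over `k`
(`B` a Noetherian domain of finite type over `k`), `𝔭 ⊆ B` a maximal ideal such that `ι 𝔭` is singular and every
other point of `Spec B` is regular, `B → C` a flat finitely presented chart whose image contains `𝔭`, and `I ⊆ B` with
`𝔭ⁿ ⊆ I ⊆ 𝔭`, `I ≠ 0`, `Bl_{IC}(Spec C)` regular. Then `ι 𝔭` has the local resolution datum `hloc`
(`…ChartTransfer.coneModelData_of_flat_chart` + `hloc_of_affineOpen_model` on `Spec B_h`). [cite: Kollar2007, §2.2] -/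
theorem hloc_of_flat_chart (k : Type) [Field k] (X : Scheme.{0}) [IsIntegral X]
    (f : X ⟶ Spec (.of k)) [LocallyOfFiniteType f]
    {B C : Type} [CommRing B] [CommRing C] [Algebra B C] [IsDomain B] [IsNoetherianRing B]
    [Algebra k B] [Algebra.FiniteType k B] [Module.Flat B C] [Algebra.FinitePresentation B C]
    (ι : Spec (.of B) ⟶ X) [IsOpenImmersion ι] (hι : ι ≫ f = Spec.map (CommRingCat.ofHom (algebraMap k B)))
    (𝔭 : Ideal B) [h𝔭 : 𝔭.IsMaximal] (I : Ideal B) (hIfg : I.FG) (hI0 : I ≠ ⊥) {n : ℕ} (hpI : 𝔭 ^ n ≤ I)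
    (hIp : I ≤ 𝔭)
    (h𝔭C : (⟨𝔭, h𝔭.isPrime⟩ : PrimeSpectrum B) ∈ Set.range (PrimeSpectrum.comap (algebraMap B C)))
    (hregC : Scheme.IsRegular (affineBlowup (I.map (algebraMap B C))))
    (hsing : (⟨𝔭, h𝔭.isPrime⟩ : Spec (.of B)) ∉ Scheme.regularLocus (Spec (.of B)))
    (hregB : ∀ P : Spec (.of B), P.asIdeal ≠ 𝔭 → P ∈ Scheme.regularLocus (Spec (.of B))) :
    ∃ (V : X.Opens), ι ⟨𝔭, h𝔭.isPrime⟩ ∈ V ∧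
      (∀ t : X, t ∉ Scheme.regularLocus X → t ∈ V → t = ι ⟨𝔭, h𝔭.isPrime⟩) ∧
      ∃ (Y : Scheme.{0}) (ρ : Y ⟶ V), IsProper ρ ∧ Scheme.IsRegular Y ∧
        IsIso (ρ ∣_ (V.ι ⁻¹ᵁ ⟨Scheme.regularLocus X, isOpen_regularLocus_of_locallyOfFiniteType_field f⟩)) ∧
        Dense ((ρ ⁻¹ᵁ (V.ι ⁻¹ᵁ ⟨Scheme.regularLocus X,
          isOpen_regularLocus_of_locallyOfFiniteType_field f⟩) : Y.Opens) : Set Y) := by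
  obtain ⟨h, hh𝔭, hfg', hI0', hreg', hRegI', q, hq𝔭, hq⟩ :=
    ChartTransfer.coneModelData_of_flat_chart 𝔭 I hIfg hI0 hpI hIp h𝔭C hregC hsing hregB
  -- the model lives on the affine open `Spec B_h → Spec B → X`
  have hh0 : h ≠ 0 := fun h0 => hh𝔭 (h0 ▸ 𝔭.zero_mem)
  haveI : IsDomain (Localization.Away h) :=
    IsLocalization.isDomain_localization (powers_le_nonZeroDivisors_of_noZeroDivisors hh0)
  haveI : Algebra.FinitePresentation B (Localization.Away h) := IsLocalization.Away.finitePresentation h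
  haveI : Algebra.FiniteType k (Localization.Away h) :=
    Algebra.FiniteType.trans (S := B) inferInstance inferInstance
  haveI : IsOpenImmersion (Spec.map (CommRingCat.ofHom (algebraMap B (Localization.Away h)))) :=
    IsOpenImmersion.of_isLocalization h
  set ι' : Spec (.of (Localization.Away h)) ⟶ X :=
    Spec.map (CommRingCat.ofHom (algebraMap B (Localization.Away h))) ≫ ι with hι'
  have hι'f : ι' ≫ f = Spec.map (CommRingCat.ofHom (algebraMap k (Localization.Away h))) := by
    rw [hι', Category.assoc, hι, ← Spec.map_comp]
    rfl
  have hpt : ι' q = ι ⟨𝔭, h𝔭.isPrime⟩ := by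
    change ι (Spec.map (CommRingCat.ofHom (algebraMap B (Localization.Away h))) q) = _
    rw [hq𝔭]
  rw [← hpt]
  exact hloc_of_affineOpen_model k X f (Localization.Away h) ι' hι'f _ hfg' hI0' hreg' hRegI' q hq

end Summit.ResolutionOfSingularities.ResolutionOfSingularities.Theorems.FRationalResolution.ChartHloc

end
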